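import Literature.NumberTheory.Automorphic.Liu2021.LemD1RankTwoCMLetters
import HarnessLib

/-!
# [Liu2021, App. D, Lemma D.1 (4)] «if», second alternative (`LemD1_4IfAsPrintedI`): the Step-2 companion map `μ ↦ μᶜχ̌`
# is an involution, and on a TWO-member indexed family the reading reduces to ONE ordered pair

Topic `NumberTheory/Automorphic/Liu2021`; namespace `Literature.NumberTheory.Automorphic.Liu2021` (home of ★ `LemD1_4IfAsPrintedI`,
`LemD1RankTwoCMLetters.lean` ED. 3) and `….Liu2021.LemD1` (home of ★ `LemD1.muTwist`, `LemD1AsPrinted.lean`).  KERNEL ONLY: theorems; no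
definition, no named fact, no `sorry`, no instance.  Cell `hodgecm-mathlib` (D-0151), programme P5 (crux HLiu418 = stmt-HodgeConjecture-24832),
brick **B0** of the census memo `F0/P5/A-p18/g23/CENSUS-L4if-inhouse-road.A-p18g23.md` (A-p18 (g23), 2026-08-31): the bookkeeping every
in-house assembler of the last local letter L4if `LemD1RankTwoCMLetters.LemD1_4IfAsPrintedNonsplitCM₂` (P5 line ED. 7 stub
`stub_letter_lemD14_if_nonsplit`) must perform before any representation theory.

[Liu2021] Y. Liu, *Fourier–Jacobi cycles and arithmetic relative trace formula*, Camb. J. Math. **9** (2021), App. D §D.1 (TeX l. 5213–5224: Steps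
1–3, `χ̌(x) = χ(x/x^c)`) and Lemma D.1 (4) (l. 5235, p. 126): «If `n = 2` and `ω(μ, ε, χ)` is nonzero, then `ω(μ′, ε′, χ′)` is isomorphic to
`ω(μ, ε, χ)` if and only if either `(μ′, ε′, χ′) = (μ, ε, χ)`, or `μ′ = μ^c χ̌`, `χ′ = χ`, and `ε′ = ε` (resp. `ε′ ≠ ε`) when `V` is isotropic (resp.
anisotropic).»

THE MATHEMATICS (three lines of the printed proof's bookkeeping, l. 5255 «we must have either `μ′ = μ` or `μ′ = μ^c χ̌`»).
* §1 `χ̌(x^c) = χ̌(x)⁻¹` (`x^c / x^{cc} = (x / x^c)⁻¹`), hence `(μ^c)^c = μ` and **`(μ^c χ̌)^c χ̌ = μ`**: the companion map `LemD1.muTwist (·) χ`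
  of Step 2 is an INVOLUTION of `MuSet S` (`LemD1.muTwist_muTwist`).  Consequently the companion relation is symmetric
  (`LemD1.eq_muTwist_comm`): in a pair of members with `χ_j = χ_i`, `μ_j = μ_iᶜ χ̌_i ↔ μ_i = μ_jᶜ χ̌_j`.
* §2 For ANY indexed family, the «if»-reading ★ `LemD1_4IfAsPrintedI Lf` holds as soon as it holds OFF THE DIAGONAL: at `i = j` its conclusion
  `ω_i ≅ ω_i` is reflexivity (★ `AreIsomorphicRep.refl`) (`LemD1_4IfAsPrintedI.of_ne`).
* §3 For a family indexed by `Fin 2` (the shape of the letter: member `0 = (λ, a, χ)`, member `1 = (λ′, a′, χ)`), the reading is EQUIVALENT to the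
  two ordered pairs `(0,1)`, `(1,0)` (`lemD1_4IfAsPrintedI_fin_two_iff`), and — by §1, the symmetry of «isomorphic» (★ `AreIsomorphicRep.symm`)
  and of «same class» — it FOLLOWS from ONE isomorphism `ω₁ ≅ ω₀` proved under EITHER non-vanishing hypothesis `ω₀ ≠ 0 ∨ ω₁ ≠ 0` and the
  `(0,1)`-oriented side conditions (`LemD1_4IfAsPrintedI.of_fin_two`).  This is the exact proof obligation of an in-house road for L4if at a
  non-split place: «`ω(λ′, a′, χ)_v ≅ ω(λ, a, χ)_v` whenever one of them is non-zero, `μ_v(λ′) = μ_v(λ)ᶜ χ̌_v`, and `a′ ~ a` iff `diag dV` is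
  isotropic at `v`».
Nothing of [Liu2021] is asserted; HC_CM is proved only modulo the printed citations until rung 0 closes.

## References
* [Liu2021] Y. Liu, Camb. J. Math. 9 (2021), App. D §D.1 Steps 1–3 (l. 5213–5224), Lemma D.1 (4) (l. 5235; proof l. 5255).
-/

set_option autoImplicit false

noncomputable section

open Literature.RepresentationTheory.Liu2021 (OscillatorStandingData)
open Literature.RepresentationTheory.CentralCharacterQuotient (augmentation)

namespace Literature.NumberTheory.Automorphic.Liu2021

/-! ## §1 `χ̌ ∘ c = χ̌⁻¹`; `μ ↦ μ^c` and `μ ↦ μ^c χ̌` are involutions of the Step-2 set `MuSet S` -/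

namespace LemD1

section Involution

variable {F E : Type} [Field F] [CommRing E] [Algebra F E] {n : ℕ} {S : OscillatorStandingData F E n}

/-- `x^c / (x^c)^c = (x / x^c)⁻¹` in `E¹`: the map `x ↦ x / x^c` anti-commutes with `c`. [cite: Liu2021, App. D §D.1 (l. 5224)] -/
theorem divConj_map_σ (x : Eˣ) : S.divConj (Units.map (S.σ : E →* E) x) = (S.divConj x)⁻¹ := by
  apply Subtype.ext
  rw [OscillatorStandingData.coe_divConj, Subgroup.coe_inv, OscillatorStandingData.coe_divConj,
    OscillatorStandingData.map_σ_map_σ, inv_div]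

/-- `χ̌(x^c) = χ̌(x)⁻¹`. [cite: Liu2021, App. D §D.1 (l. 5224)] -/
theorem check_map_σ (χ : S.normOne →* ℂˣ) (x : Eˣ) : S.check χ (Units.map (S.σ : E →* E) x) = (S.check χ x)⁻¹ := by
  rw [OscillatorStandingData.check_apply, OscillatorStandingData.check_apply, divConj_map_σ, map_inv]

/-- Symmetry of «same class in `E^{−×}/Nm E^×`» (private copy of ★ `LemD1.SameClass.symm`, kept import-light).
[cite: Liu2021, App. D §D.1 Step 1 (l. 5217)] -/
private theorem sameClass_symm' {e e' : EpsRep S} (h : SameClass e e') : SameClass e' e := by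
  obtain ⟨x, hx⟩ := h
  exact ⟨x⁻¹, by rw [map_inv, hx, ← mul_inv, inv_mul_cancel_left]⟩

variable [TopologicalSpace E] [TopologicalSpace F] [IsTopologicalRing E] [IsModuleTopology F E]

/-- `(μ^c)^c = μ` on the Step-2 set. [cite: Liu2021, App. D Lemma D.1 (2) (l. 5231)] -/
theorem muConj_muConj (μ : MuSet S) : muConj (muConj μ) = μ := by
  apply Subtype.ext
  ext x
  rw [muConj_apply, muConj_apply, OscillatorStandingData.map_σ_map_σ]

/-- Unfolding of the companion character: `(μ^c χ̌)(x) = μ(x^c) · χ̌(x)`. [cite: Liu2021, App. D Lemma D.1 (4) (l. 5235)] -/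
theorem muTwist_apply (μ : MuSet S) (χ : ChiSet S) (x : Eˣ) :
    (muTwist μ χ).1 x = μ.1 (Units.map (S.σ : E →* E) x) * S.check χ.1 x := rfl

/-- **The companion map `μ ↦ μ^c χ̌` is an involution**: `(μ^c χ̌)^c χ̌ = μ^{cc} · (χ̌ ∘ c) · χ̌ = μ`.
[cite: Liu2021, App. D Lemma D.1 (4) (l. 5235; proof l. 5255)] -/
theorem muTwist_muTwist (μ : MuSet S) (χ : ChiSet S) : muTwist (muTwist μ χ) χ = μ := by
  apply Subtype.ext
  ext x
  rw [muTwist_apply, muTwist_apply, OscillatorStandingData.map_σ_map_σ, check_map_σ, mul_assoc, inv_mul_cancel, mul_one]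

/-- The companion relation is symmetric: `μ′ = μ^c χ̌ ↔ μ = μ′^c χ̌`. [cite: Liu2021, App. D Lemma D.1 (4) (l. 5235)] -/
theorem eq_muTwist_comm {μ μ' : MuSet S} {χ : ChiSet S} : μ' = muTwist μ χ ↔ μ = muTwist μ' χ := by
  constructor
  · rintro rfl
    rw [muTwist_muTwist]
  · rintro rfl
    rw [muTwist_muTwist]

end Involution

end LemD1

/-! ## §2 The «if»-reading off the diagonal suffices (any index type) -/

namespace LemD1_4IfAsPrintedI

variable {F E : Type} [Field F] [ValuativeRel F] [TopologicalSpace F] [CommRing E] [Algebra F E]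
  [TopologicalSpace E] [IsTopologicalRing E] {n : ℕ} {ι : Type} {Lf : LemD1IndexedFamily F E n ι}

/-- **Off-diagonal reduction.**  `LemD1_4IfAsPrintedI Lf` holds as soon as its conclusion holds for every pair of DISTINCT members: at
`i = j` the conclusion `ω_i ≅ ω_i` is reflexivity of «isomorphic» (READING L7). [cite: Liu2021, App. D Lemma D.1 (4) (l. 5235)] -/
theorem of_ne
    (h : letI : IsModuleTopology F E := Lf.isModuleTopology
      n = 2 → ∀ i j : ι, i ≠ j → Nontrivial (Lf.V i ⧸ augmentation (Lf.omega i) Lf.S.scalar (Lf.chi i).1) →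
        Lf.mu j = LemD1.muTwist (Lf.mu i) (Lf.chi i) → Lf.chi j = Lf.chi i →
        (LemD1.IsIsotropic Lf.S → LemD1.SameClass (Lf.eps i) (Lf.eps j)) →
        (¬ LemD1.IsIsotropic Lf.S → ¬ LemD1.SameClass (Lf.eps i) (Lf.eps j)) → AreIsomorphicRep (Lf.quot j) (Lf.quot i)) :
    LemD1_4IfAsPrintedI Lf := by
  intro hn i hi j hμ hχ hiso han
  by_cases hij : i = j
  · subst hij
    exact AreIsomorphicRep.refl _
  · exact h hn i j hij hi hμ hχ hiso han

/-- The converse bookkeeping: the reading restricted to a pair of members. [cite: Liu2021, App. D Lemma D.1 (4) (l. 5235)] -/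
theorem apply_pair (h : LemD1_4IfAsPrintedI Lf) (hn : n = 2) (i j : ι)
    (hi : Nontrivial (Lf.V i ⧸ augmentation (Lf.omega i) Lf.S.scalar (Lf.chi i).1))
    (hμ : letI : IsModuleTopology F E := Lf.isModuleTopology; Lf.mu j = LemD1.muTwist (Lf.mu i) (Lf.chi i))
    (hχ : Lf.chi j = Lf.chi i) (hiso : LemD1.IsIsotropic Lf.S → LemD1.SameClass (Lf.eps i) (Lf.eps j))
    (han : ¬ LemD1.IsIsotropic Lf.S → ¬ LemD1.SameClass (Lf.eps i) (Lf.eps j)) :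
    AreIsomorphicRep (Lf.quot j) (Lf.quot i) :=
  h hn i hi j hμ hχ hiso han

end LemD1_4IfAsPrintedI

/-! ## §3 Two members: the reading = the two ordered pairs = ONE isomorphism under either non-vanishing hypothesis -/

section FinTwo

variable {F E : Type} [Field F] [ValuativeRel F] [TopologicalSpace F] [CommRing E] [Algebra F E]
  [TopologicalSpace E] [IsTopologicalRing E] {n : ℕ} {Lf : LemD1IndexedFamily F E n (Fin 2)}

/-- **Two members: `LemD1_4IfAsPrintedI` IS the conjunction of the ordered pairs `(0,1)` and `(1,0)`** (the diagonal pairs are reflexivity).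
[cite: Liu2021, App. D Lemma D.1 (4) (l. 5235)] -/
theorem lemD1_4IfAsPrintedI_fin_two_iff :
    LemD1_4IfAsPrintedI Lf ↔
      letI : IsModuleTopology F E := Lf.isModuleTopology
      n = 2 →
        (Nontrivial (Lf.V 0 ⧸ augmentation (Lf.omega 0) Lf.S.scalar (Lf.chi 0).1) →
            Lf.mu 1 = LemD1.muTwist (Lf.mu 0) (Lf.chi 0) → Lf.chi 1 = Lf.chi 0 →
            (LemD1.IsIsotropic Lf.S → LemD1.SameClass (Lf.eps 0) (Lf.eps 1)) →
            (¬ LemD1.IsIsotropic Lf.S → ¬ LemD1.SameClass (Lf.eps 0) (Lf.eps 1)) → AreIsomorphicRep (Lf.quot 1) (Lf.quot 0)) ∧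
        (Nontrivial (Lf.V 1 ⧸ augmentation (Lf.omega 1) Lf.S.scalar (Lf.chi 1).1) →
            Lf.mu 0 = LemD1.muTwist (Lf.mu 1) (Lf.chi 1) → Lf.chi 0 = Lf.chi 1 →
            (LemD1.IsIsotropic Lf.S → LemD1.SameClass (Lf.eps 1) (Lf.eps 0)) →
            (¬ LemD1.IsIsotropic Lf.S → ¬ LemD1.SameClass (Lf.eps 1) (Lf.eps 0)) → AreIsomorphicRep (Lf.quot 0) (Lf.quot 1)) := by
  constructor
  · intro h hn
    exact ⟨fun hi hμ hχ hiso han => h hn 0 hi 1 hμ hχ hiso han, fun hi hμ hχ hiso han => h hn 1 hi 0 hμ hχ hiso han⟩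
  · intro h
    refine LemD1_4IfAsPrintedI.of_ne fun hn i j hij => ?_
    obtain ⟨h01, h10⟩ := h hn
    fin_cases i <;> fin_cases j
    · exact absurd rfl hij
    · exact h01
    · exact h10
    · exact absurd rfl hij

/-- **Two members: ONE isomorphism suffices.**  If `ω₁ ≅ ω₀` whenever ONE of `ω₀`, `ω₁` is non-zero, `μ₁ = μ₀ᶜ χ̌₀`, `χ₁ = χ₀`, and
`ε₁ ~ ε₀` exactly when `V` is isotropic, then the «if»-reading of [Lem. D.1 (4)] holds for the two-member family — the pair `(1,0)`
follows by the symmetry of «isomorphic», of «same class», and of the companion relation (`LemD1.muTwist_muTwist`).  The proof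
obligation of an in-house L4if at one place. [cite: Liu2021, App. D Lemma D.1 (4) (l. 5235; proof l. 5255)] -/
theorem LemD1_4IfAsPrintedI.of_fin_two
    (h : letI : IsModuleTopology F E := Lf.isModuleTopology
      n = 2 →
        (Nontrivial (Lf.V 0 ⧸ augmentation (Lf.omega 0) Lf.S.scalar (Lf.chi 0).1) ∨
          Nontrivial (Lf.V 1 ⧸ augmentation (Lf.omega 1) Lf.S.scalar (Lf.chi 1).1)) →
        Lf.mu 1 = LemD1.muTwist (Lf.mu 0) (Lf.chi 0) → Lf.chi 1 = Lf.chi 0 →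
        (LemD1.IsIsotropic Lf.S → LemD1.SameClass (Lf.eps 0) (Lf.eps 1)) →
        (¬ LemD1.IsIsotropic Lf.S → ¬ LemD1.SameClass (Lf.eps 0) (Lf.eps 1)) → AreIsomorphicRep (Lf.quot 1) (Lf.quot 0)) :
    LemD1_4IfAsPrintedI Lf := by
  letI : IsModuleTopology F E := Lf.isModuleTopology
  refine lemD1_4IfAsPrintedI_fin_two_iff.2 fun hn => ⟨fun hi => h hn (Or.inl hi), fun hi hμ hχ hiso han => ?_⟩
  refine AreIsomorphicRep.symm (h hn (Or.inr hi) ?_ hχ.symm (fun hV => LemD1.sameClass_symm' (hiso hV))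
    (fun hV hs => han hV (LemD1.sameClass_symm' hs)))
  rw [hχ]
  exact LemD1.eq_muTwist_comm.1 hμ

end FinTwo

end Literature.NumberTheory.Automorphic.Liu2021

end
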